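/-
Copyright: b2b-lace packet (carver gen 32).  THE TAIL-COUNT DOMINATION LICENCE for the monotone lookup
("MLU") of `I_{n,l}` into a finite table of class points: if the absolute-value profile of `z` dominates a
sorted non-negative `b` in the distribution sense — `#{j : b_j ≥ t} ≤ #{μ : |z_μ| ≥ t}` for every `t ≥ 1` —
then `I_{n,l}(z) ≤ I_{n,l}(b)`.  d-generic; no numeral; no `sorry`.
-/
import Literature.Probability.FitznerVanDerHofstad2017.SrwIntegralSortedMonotone
import HarnessLib

/-!
# Tail-count domination ⇒ `I_{n,l}(z) ≤ I_{n,l}(b)` (the monotone-lookup licence)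

CITATION HEADER (PLACEMENT v2). This module is part of a certified REPRODUCTION of:
R. Fitzner, R. van der Hofstad, *Mean-field behavior for nearest-neighbor percolation in d > 10*,
Electron. J. Probab. 22 (2017), no. 43 [FvdH17], and *Generalized approach to the non-backtracking lace
expansion*, Probab. Theory Related Fields 169 (2017) 1041–1119 [NoBLE17-I] (arXiv:1506.07977, 1506.07969).
Reproduces: the MONOTONICITY step of the notebook's simplification of `K[n,l,x]` / `W`-tables
(Lemma 5.1 p. 1093: `I_{n,l}(x + y) ≤ I_{n,l}(x)` for non-negative `x, y`, `n ≥ 1`, `d ≥ 2n+1`), in the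
form a KERNEL evaluator consumes: a point `z ∈ ℤ^d` reached inside a placement sum (5.16) p. 1092 is
bounded by the tabulated value at any class point `b` whose sorted profile lies termwise below the sorted
absolute profile of `z`; the test is stated through TAIL COUNTS, so that no sorting happens in the kernel.
Origin: build `lace`, node W-PATTERN (carver gen 32, unit b2b-lace-carver-g32), part (P2); consumer:
the d := 10 pattern-law tables (`SrwWPatternTablesD10`) and any `…_of_farValues` hook of
`WbxCellExactKernel`.

## What is here (all `d`-generic)

* `absTailCount z t = #{μ : t ≤ |z μ|}` and its `W_d`-invariance `absTailCount_spAct`.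
* `le_of_antitone_of_absTailCount_le`: two sorted (non-increasing) non-negative vectors `a, b` with
  `absTailCount b t ≤ absTailCount a t` for all `t ≥ 1` satisfy `b ≤ a` termwise.
* `srwI_le_of_absTailCount_le`: the licence `I_{n,l}(z) ≤ I_{n,l}(b)` (`1 ≤ n`, `2n+1 ≤ d`, `b` antitone
  and non-negative, tail counts of `b` dominated by those of `z`) — `exists_spAct_sorted` +
  `absMonotone_srwI` + `srwI_spAct`.
* `srwI_le_of_absTailCount_le_upTo`: the same with the test restricted to `1 ≤ t ≤ T` for any bound
  `T` of `b` (the finite test a kernel runs).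
-/

namespace Literature.Probability.FitznerVanDerHofstad2017

open Finset

variable {d : ℕ}

/-- The tail count of the absolute profile: `#{μ : t ≤ |z μ|}`.
[cite: FitznerVanDerHofstad2016NoBLE, Lemma 5.1 p. 1093] -/
def absTailCount (z : Fin d → ℤ) (t : ℤ) : ℕ := (univ.filter fun μ => t ≤ |z μ|).card

/-- `W_d`-invariance of the tail counts. [cite: FitznerVanDerHofstad2016NoBLE, (3.35) p. 1071] -/
theorem absTailCount_spAct (τ : SgnPermPair d) (z : Fin d → ℤ) (t : ℤ) :
    absTailCount (spAct τ z) t = absTailCount z t := by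
  classical
  unfold absTailCount
  have habs : ∀ μ, |spAct τ z μ| = |z (τ.1 μ)| := fun μ => by
    rw [spAct_apply, abs_mul]
    rcases Int.units_eq_one_or (τ.2 μ) with h | h <;> simp [h]
  simp_rw [habs]
  rw [← Finset.card_map τ.1.toEmbedding]
  congr 1
  ext ν
  simp only [mem_map_equiv, mem_filter, mem_univ, true_and]
  constructor
  · intro h; simpa using h
  · intro h; simpa using h

/-- Two sorted non-negative vectors whose tail counts are ordered are ordered termwise.
[cite: FitznerVanDerHofstad2016NoBLE, Lemma 5.1 p. 1093] -/
theorem le_of_antitone_of_absTailCount_le (a b : Fin d → ℤ) (ha : Antitone a) (hb : Antitone b)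
    (ha0 : ∀ j, 0 ≤ a j)
    (hdom : ∀ t : ℤ, 1 ≤ t → absTailCount b t ≤ absTailCount a t) : ∀ j, b j ≤ a j := by
  classical
  intro j
  by_contra hlt
  push Not at hlt
  set t : ℤ := b j with ht
  have ht1 : 1 ≤ t := by have := ha0 j; omega
  -- every `i ≤ j` has `b i ≥ b j = t`
  have hB : (Iic j).card ≤ absTailCount b t := by
    unfold absTailCount
    refine card_le_card fun i hi => ?_
    rw [mem_Iic] at hi
    rw [mem_filter]
    refine ⟨mem_univ _, ?_⟩
    have h1 : b j ≤ b i := hb hi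
    have h2 : b i ≤ |b i| := le_abs_self _
    exact h1.trans h2
  -- every `μ` with `|a μ| ≥ t` lies strictly below `j`
  have hA : absTailCount a t ≤ (Iio j).card := by
    unfold absTailCount
    refine card_le_card fun μ hμ => ?_
    rw [mem_filter] at hμ
    rw [mem_Iio]
    by_contra hμj
    push Not at hμj
    have h1 : a μ ≤ a j := ha hμj
    have h2 : |a μ| = a μ := abs_of_nonneg (ha0 μ)
    have h3 := hμ.2
    rw [h2] at h3
    omega
  have h := hdom t ht1
  rw [Fin.card_Iic] at hB
  rw [Fin.card_Iio] at hA
  omega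

/-- **The monotone-lookup licence.** If `b` is sorted non-increasing and non-negative and its tail counts
are dominated by those of `|z|`, then `I_{n,l}(z) ≤ I_{n,l}(b)` (`1 ≤ n`, `2n+1 ≤ d`).
[cite: FitznerVanDerHofstad2016NoBLE, Lemma 5.1 p. 1093] -/
theorem srwI_le_of_absTailCount_le {n : ℕ} (hn : 1 ≤ n) (hd : 2 * n + 1 ≤ d) (l : ℕ)
    (z b : Fin d → ℤ) (hb : Antitone b) (hb0 : ∀ j, 0 ≤ b j)
    (hdom : ∀ t : ℤ, 1 ≤ t → absTailCount b t ≤ absTailCount z t) :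
    srwI d n l z ≤ srwI d n l b := by
  obtain ⟨τ, hanti, hnn, -, -⟩ := exists_spAct_sorted z
  have hdom' : ∀ t : ℤ, 1 ≤ t → absTailCount b t ≤ absTailCount (spAct τ z) t := fun t ht => by
    rw [absTailCount_spAct]; exact hdom t ht
  have hle := le_of_antitone_of_absTailCount_le (spAct τ z) b hanti hb hnn hdom'
  rw [← srwI_spAct n l τ z]
  exact absMonotone_srwI hn hd l (spAct τ z) b fun μ => by
    rw [abs_of_nonneg (hb0 μ), abs_of_nonneg (hnn μ)]; exact hle μ

/-- Beyond a bound of `b` its tail counts vanish. [cite: FitznerVanDerHofstad2016NoBLE, Lemma 5.1 p. 1093] -/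
theorem absTailCount_eq_zero_of_lt (b : Fin d → ℤ) (T t : ℤ) (hbT : ∀ j, |b j| ≤ T) (hTt : T < t) :
    absTailCount b t = 0 := by
  classical
  unfold absTailCount
  rw [card_eq_zero, filter_eq_empty_iff]
  intro j _
  have := hbT j
  omega

/-- The licence with the FINITE test `1 ≤ t ≤ T` (`T` any bound of `b`), as a kernel runs it.
[cite: FitznerVanDerHofstad2016NoBLE, Lemma 5.1 p. 1093] -/
theorem srwI_le_of_absTailCount_le_upTo {n : ℕ} (hn : 1 ≤ n) (hd : 2 * n + 1 ≤ d) (l : ℕ)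
    (z b : Fin d → ℤ) (hb : Antitone b) (hb0 : ∀ j, 0 ≤ b j) (T : ℤ) (hbT : ∀ j, b j ≤ T)
    (hdom : ∀ t : ℤ, 1 ≤ t → t ≤ T → absTailCount b t ≤ absTailCount z t) :
    srwI d n l z ≤ srwI d n l b := by
  refine srwI_le_of_absTailCount_le hn hd l z b hb hb0 fun t ht => ?_
  by_cases htT : t ≤ T
  · exact hdom t ht htT
  · rw [absTailCount_eq_zero_of_lt b T t (fun j => by rw [abs_of_nonneg (hb0 j)]; exact hbT j)
      (not_le.mp htT)]
    exact Nat.zero_le _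

end Literature.Probability.FitznerVanDerHofstad2017
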